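import Summits.ResolutionOfSingularities.ResolutionOfSingularities.Theorems.DescentDescentPerfectToAllOfCleanModels
import Summits.ResolutionOfSingularities.ResolutionOfSingularities.Theorems.PAlterationPicoverIffDegP
import Summits.ResolutionOfSingularities.ResolutionOfSingularities.Theorems.PAlterationPicoverLocalModelGiraudReductionGraded
import Literature.AlgebraicGeometry.Resolution.LogRegularResolutionGeneralHolds
import HarnessLib

/-!
# Crux `PicoverLocalModel` (stmt-ResolutionOfSingularities-0557): two unconditional edges after Kato 1994 (10.4)

`PAlteration.PicoverLocalModel` (the hypersurface `T^p = a` over a regular affine base has a resolution) now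
follows, sorry-free, from EITHER research statement below — the literature input Kato 1994 (10.4) being a theorem
of the tree since 2026-08-27 (`Kato1994_logRegular_hasResolution_general_holds`):

* `picoverLocalModel_of_cleanModels` — from `RadicialJung.CleanModels` (stmt-15917, pointwise log-clean models):
  `CleanModels → Picover` (`Theorems.picover_of_cleanModels`, via `CleanResolves` = game + Kato) and
  `Picover → PicoverLocalModel` (`picoverLocalModel_of_picover`, landed);
* `picoverLocalModel_of_cossartNormalForm_ge_two` — from the 0557 line's own research stub (Cossart's normal form
  in dimension `≥ 2`, `InGiraudNormalForm` on a regular snc model): the landed bridge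
  `PicoverLocalModel.GiraudReductionGraded.picoverLocalModel_of_kato_of_normalForm_ge_two` with its Kato hypothesis
  discharged.

No new mathematics; 0557, 15917 and the Cossart stub remain open.
-/

noncomputable section

set_option linter.dupNamespace false -- mandated namespace of this single-conjunct summit

open CategoryTheory AlgebraicGeometry
open Literature.AlgebraicGeometry.Resolution

namespace Summit.ResolutionOfSingularities.ResolutionOfSingularities.Theorems

/-- **`CleanModels ⇒ PicoverLocalModel`** (stmt-15917 ⇒ stmt-0557): pointwise log-clean models give `Picover`
(`picover_of_cleanModels`), which specialises to its local model (`picoverLocalModel_of_picover`). [folklore] -/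
theorem picoverLocalModel_of_cleanModels
    (hCM : Summit.ResolutionOfSingularities.ResolutionOfSingularities.Theses.RadicialJung.CleanModels) :
    Summit.ResolutionOfSingularities.ResolutionOfSingularities.Theses.PAlteration.PicoverLocalModel :=
  Picover.IffDegP.picoverLocalModel_of_picover (picover_of_cleanModels hCM)

/-- **Cossart normal form in dimension `≥ 2` ⇒ `PicoverLocalModel`**, with Kato 1994 (10.4) discharged: the 0557
line's bridge `picoverLocalModel_of_kato_of_normalForm_ge_two` fed with
`Kato1994_logRegular_hasResolution_general_holds`. [folklore] -/
theorem picoverLocalModel_of_cossartNormalForm_ge_two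
    (hNF₂ : ∀ (n : ℕ), 2 ≤ n → ∀ (p : ℕ), p.Prime → ∀ (k : Type) [Field k] [CharP k p]
      (R : Type) [CommRing R] [IsDomain R] [Algebra k R], Algebra.FiniteType k R →
      IsRegularRing R → ringKrullDim R ≤ n → ∀ a : R, (∀ b : R, b ^ p ≠ a) →
        ∃ (W : Scheme.{0}) (π : W ⟶ Spec (.of R)) (E : List W.IdealSheafData),
          IsProper π ∧ IsBirational π ∧ IsIntegral W ∧ Scheme.IsRegular W ∧ HasSNC E ∧
            InGiraudNormalForm p W π a E) :
    Summit.ResolutionOfSingularities.ResolutionOfSingularities.Theses.PAlteration.PicoverLocalModel :=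
  PicoverLocalModel.GiraudReductionGraded.picoverLocalModel_of_kato_of_normalForm_ge_two
    Kato1994_logRegular_hasResolution_general_holds.{0} hNF₂

end Summit.ResolutionOfSingularities.ResolutionOfSingularities.Theorems

end
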